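import Literature.NumberTheory.NumberFields.IdealClassCoprimeRepresentative
import HarnessLib

/-!
# `𝔟 + (M) = (1) ⇒ gcd(N𝔟, M) = 1`: norms of ideals prime to a level, and the coprime class representative with norm prime to `M`

Topic `Literature/NumberTheory/NumberFields`, namespace `Literature.NumberTheory.NumberFields` (sequel of ★ `IdealClassCoprimeRepresentative`, which treats
the case `M = p` prime: `sup_span_natCast_eq_top_iff_not_dvd_absNorm`).  THEOREMS ONLY (no `def`, no instance, no named fact, no `sorry`).  Cell
`hodgecm-mathlib` (D-0151), P6 «MOD» (crux hLiu418 = stmt-HodgeConjecture-24832, `--supports`, count-neutral): line L3 (`stub_FROB`), ROOF road (ρ-𝔟):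
the PERFECTNESS input of the engine's `hcard` wants the exponent `n` of `A[𝔟]` prime not only to `p` but to a composite level `M` (`gcd(n, #K(Θ_s)) = 1`,
LA6-p03 (g0) (C3) 2026-09-02T04:2xZ «arrangeable by ★ `exists_coprime_representative_nat_mem`») — this file arranges it: choose `𝔟 ~ 𝔞` prime to `(M)`
(★ (NT-𝔟)), then `N𝔟` (resp. `N(𝔟 · c𝔟) = N𝔟²`) is a natural number in `𝔟` (resp. in `𝔟 · c𝔟`) COPRIME TO `M`.  Milne, *Algebraic Number Theory* Thm. 3.7 ∕
Rem. 3.12 (unique factorisation, `N(𝔞𝔟) = N𝔞 · N𝔟`, `N𝔞 ∈ 𝔞`); Neukirch Ch. VI §1 (classes prime to a modulus).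

* `absNorm_coprime_of_sup_span_natCast_eq_top_of_ne` — `𝔟 ≠ 0`, `𝔟 ⊔ (M) = ⊤` ⇒ `Nat.Coprime (N𝔟) M` (any `M : ℕ`; prime by prime over ★ `not_dvd_absNorm_…`);
  `sup_span_natCast_eq_top_of_absNorm_coprime` (converse for `M ≠ 0`… stated as: every prime `ℓ ∣ M` has `𝔟 ⊔ (ℓ) = ⊤`);
* `exists_nat_mem_coprime_level` — `∃ n ≥ 1`, `Nat.Coprime n M`, `n ∈ 𝔟` (namely `N𝔟`); CM product form `exists_nat_mem_mul_complexConj_smul_coprime_level`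
  (`n ∈ 𝔟 · c𝔟`, namely `N(𝔟 · c𝔟)`);
* **`exists_coprime_representative_coprime_level`** — (NT-𝔟)+(NT-n) at a composite level: for `𝔞 ≠ 0`, `m ≠ 0`, `m ≤ (M)`: `x ≠ 0`, `𝔟 = (x)·𝔞` integral with
  `𝔟 ⊔ m = ⊤`, and `n ≥ 1` coprime to `M` with `n ∈ 𝔟 · c𝔟 ⊆ 𝔟`.
`--supports stmt-HodgeConjecture-24832`.
-/

namespace Literature.NumberTheory.NumberFields

open NumberField IsDedekindDomain
open scoped nonZeroDivisors Pointwise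

variable {F : Type*} [Field F] [NumberField F]

/-- **`𝔟 ⊔ (M) = ⊤ ⇒ gcd(N𝔟, M) = 1`** (`𝔟 ≠ 0`): a prime `ℓ ∣ M` dividing `N𝔟` would give `𝔟 ⊔ (ℓ) = ⊤` (as `(M) ⊆ (ℓ)`) and `ℓ ∣ N𝔟`, against ★
`not_dvd_absNorm_of_sup_span_natCast_eq_top`. [cite: MilneANT2008, Thm. 3.7 (p. 42)] -/
theorem absNorm_coprime_of_sup_span_natCast_eq_top_of_ne {𝔟 : Ideal (𝓞 F)} (h𝔟 : 𝔟 ≠ ⊥) {M : ℕ}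
    (hcop : 𝔟 ⊔ Ideal.span {((M : ℕ) : 𝓞 F)} = ⊤) : Nat.Coprime (Ideal.absNorm 𝔟) M := by
  refine Nat.coprime_of_dvd fun ℓ hℓ hℓN hℓM => ?_
  have hle : Ideal.span {((M : ℕ) : 𝓞 F)} ≤ Ideal.span {((ℓ : ℕ) : 𝓞 F)} :=
    Ideal.span_singleton_le_span_singleton.mpr (Nat.cast_dvd_cast hℓM)
  have hcopℓ : 𝔟 ⊔ Ideal.span {((ℓ : ℕ) : 𝓞 F)} = ⊤ := top_le_iff.mp (hcop.ge.trans (sup_le_sup_left hle _))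
  exact not_dvd_absNorm_of_sup_span_natCast_eq_top h𝔟 hℓ hcopℓ hℓN

/-- Conversely, `gcd(N𝔟, M) = 1` gives `𝔟 ⊔ (ℓ) = ⊤` for every prime `ℓ ∣ M` (★ `sup_span_natCast_eq_top_of_not_dvd_absNorm`).
[cite: MilneANT2008, Thm. 3.7 (p. 42)] -/
theorem sup_span_natCast_eq_top_of_absNorm_coprime {𝔟 : Ideal (𝓞 F)} {M : ℕ} (h : Nat.Coprime (Ideal.absNorm 𝔟) M)
    {ℓ : ℕ} (hℓ : ℓ.Prime) (hℓM : ℓ ∣ M) : 𝔟 ⊔ Ideal.span {((ℓ : ℕ) : 𝓞 F)} = ⊤ :=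
  sup_span_natCast_eq_top_of_not_dvd_absNorm hℓ fun hℓN =>
    hℓ.one_lt.ne' (Nat.eq_one_of_dvd_coprimes h hℓN hℓM)

/-- **A natural number in `𝔟` coprime to the level `M`**: `𝔟 ≠ 0`, `𝔟 ⊔ (M) = ⊤` ⇒ `0 < N𝔟`, `gcd(N𝔟, M) = 1`, `N𝔟 ∈ 𝔟`.
[cite: MilneANT2008, Thm. 3.7 (p. 42)] -/
theorem exists_nat_mem_coprime_level {𝔟 : Ideal (𝓞 F)} (h𝔟 : 𝔟 ≠ ⊥) {M : ℕ} (hcop : 𝔟 ⊔ Ideal.span {((M : ℕ) : 𝓞 F)} = ⊤) :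
    ∃ n : ℕ, 0 < n ∧ Nat.Coprime n M ∧ ((n : ℕ) : 𝓞 F) ∈ 𝔟 :=
  ⟨Ideal.absNorm 𝔟, Nat.pos_of_ne_zero (by rwa [Ne, Ideal.absNorm_eq_zero_iff]), absNorm_coprime_of_sup_span_natCast_eq_top_of_ne h𝔟 hcop,
    Ideal.absNorm_mem 𝔟⟩

section Pointwise

variable {G : Type*} [Group G] [MulSemiringAction G (𝓞 F)]

omit [NumberField F] in
/-- `𝔟 ⊔ (M) = ⊤ ⇒ (𝔟 · σ𝔟) ⊔ (M) = ⊤` for a ring automorphism `σ` (★ `mul_pointwise_smul_sup_eq_top_of_sup_span_natCast_eq_top`, restated at a composite `M` —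
the ★ lemma is already stated for any natural number). [cite: NeukirchANT1999, Ch. I §9 (conjugate ideals `σ𝔞` under automorphisms, before (9.1))] -/
theorem mul_pointwise_smul_ne_bot (g : G) {𝔟 : Ideal (𝓞 F)} (h𝔟 : 𝔟 ≠ ⊥) : 𝔟 * g • 𝔟 ≠ ⊥ :=
  mul_ne_zero h𝔟 (pointwise_smul_ne_bot g h𝔟)

end Pointwise

/-- **CM product form at a composite level**: `𝔟 ≠ 0`, `𝔟 ⊔ (M) = ⊤` ⇒ some `n ≥ 1` with `gcd(n, M) = 1` lies in `𝔟 · c𝔟` (namely `n = N(𝔟 · c𝔟) = N𝔟²`).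
[cite: MilneANT2008, Thm. 3.7 (p. 42)] -/
theorem exists_nat_mem_mul_complexConj_smul_coprime_level [IsCMField F] {𝔟 : Ideal (𝓞 F)} (h𝔟 : 𝔟 ≠ ⊥) {M : ℕ}
    (hcop : 𝔟 ⊔ Ideal.span {((M : ℕ) : 𝓞 F)} = ⊤) :
    ∃ n : ℕ, 0 < n ∧ Nat.Coprime n M ∧ ((n : ℕ) : 𝓞 F) ∈ 𝔟 * (IsCMField.complexConj F) • 𝔟 :=
  exists_nat_mem_coprime_level (mul_pointwise_smul_ne_bot (IsCMField.complexConj F) h𝔟)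
    (mul_pointwise_smul_sup_eq_top_of_sup_span_natCast_eq_top (IsCMField.complexConj F) hcop)

/-- **(NT-𝔟)+(NT-n) AT A COMPOSITE LEVEL `M`** (the perfectness∕`hcard` input `gcd(n, p · #K(Θ_s) · …) = 1` in one `obtain`): for `𝔞 ≠ 0`, a nonzero `m ⊆ (M)`
(e.g. `m = (M)`, `M = p · #K(Θ_s) · N`), there are `x ∈ F^×`, an integral `𝔟 = (x) · 𝔞` with `𝔟 ≠ 0`, `𝔟 ⊔ m = ⊤`, `𝔟 ⊔ (M) = ⊤`, and `n ≥ 1` with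
`gcd(n, M) = 1`, `n ∈ 𝔟 · c𝔟` and `n ∈ 𝔟`. [cite: NeukirchANT1999, Ch. VI §1 (every class of `Cl_K` contains an ideal prime to a given ideal)] -/
theorem exists_coprime_representative_coprime_level [IsCMField F] (𝔞 m : Ideal (𝓞 F)) (h𝔞 : 𝔞 ≠ ⊥) (hm : m ≠ ⊥) {M : ℕ}
    (hmM : m ≤ Ideal.span {((M : ℕ) : 𝓞 F)}) :
    ∃ (x : F) (𝔟 : Ideal (𝓞 F)) (n : ℕ), x ≠ 0 ∧ 𝔟 ≠ ⊥ ∧ 𝔟 ⊔ m = ⊤ ∧ 𝔟 ⊔ Ideal.span {((M : ℕ) : 𝓞 F)} = ⊤ ∧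
      (𝔟 : FractionalIdeal (𝓞 F)⁰ F) = FractionalIdeal.spanSingleton (𝓞 F)⁰ x * (𝔞 : FractionalIdeal (𝓞 F)⁰ F) ∧
      0 < n ∧ Nat.Coprime n M ∧ ((n : ℕ) : 𝓞 F) ∈ 𝔟 * (IsCMField.complexConj F) • 𝔟 ∧ ((n : ℕ) : 𝓞 F) ∈ 𝔟 := by
  obtain ⟨x, 𝔟, hx, h𝔟m, h𝔟x⟩ := RingOfIntegers.exists_coprime_representative 𝔞 m h𝔞 hm
  have h𝔟0 : 𝔟 ≠ ⊥ := by
    rintro rfl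
    rw [FractionalIdeal.coeIdeal_bot, eq_comm, mul_eq_zero, FractionalIdeal.spanSingleton_eq_zero_iff,
      FractionalIdeal.coeIdeal_eq_zero] at h𝔟x
    rcases h𝔟x with h | h
    · exact hx h
    · exact h𝔞 h
  have h𝔟M : 𝔟 ⊔ Ideal.span {((M : ℕ) : 𝓞 F)} = ⊤ := top_le_iff.mp (h𝔟m.ge.trans (sup_le_sup_left hmM _))
  obtain ⟨n, hn0, hn, hmem⟩ := exists_nat_mem_mul_complexConj_smul_coprime_level h𝔟0 h𝔟M
  exact ⟨x, 𝔟, n, hx, h𝔟0, h𝔟m, h𝔟M, h𝔟x, hn0, hn, hmem, Ideal.mul_le_right hmem⟩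

end Literature.NumberTheory.NumberFields
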